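/-
Origin: expansion seat `planner-pub-hodgecm-pv07-g4-0`, handover #1 2026-08-18T11:22:34Z (`HOME/pub-hodgecm-pv07-g4/lean/Pv07g4/GenuineSchrodingerCoeff.lean`, md5 59f8c12d, 732 lines);
landed by the gen-8 packager in gate run 29 as `HodgeCM/PerL34/GenuineSchrodingerCoeff.lean` (import ^import Pv13g4\.GenuineSchrodingerModel[ \t]*$→import HodgeCM.PerL34.GenuineSchrodingerModel ×1).
-/
/-
Copyright (c) 2026. All rights reserved.
Released under Apache 2.0 license as described in the file LICENSE.

# `HodgeCM/PerL34/GenuineSchrodingerCoeff.lean` — the torus-side END binders `hK`, `hM`, `hloc`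
# in the genuine global split Schrödinger model (DAG-node prover #07 gen 4, unit `pub-hodgecm-pv07-g4`, RUN 29)

WIP module name `Pv07g4.GenuineSchrodingerCoeff`; lands as `HodgeCM.PerL34.GenuineSchrodingerCoeff`.
Imports pv13-g4's `GenuineSchrodingerModel` (WIP name `Pv13g4.GenuineSchrodingerModel`, lands as
`HodgeCM.PerL34.GenuineSchrodingerModel`; ONE import rewrite at intake) — nothing else of the tree is touched.

## What this file proves (no placeholders, no new axioms, no cited facts)

pv13-g4's model: `X = Πʳ_{v split} [(L⁺_v)³, 𝒪_v³]` (`SchrodingerModel.Space`), Haar measure `dx` with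
`vol(∏ 𝒪_v³) = 1` (`μ`), the model group `U(1)(𝔸_{L⁺}) = Model L` acting through the split base charts, the
dilation representation `rep L ν` (`(ω(k) f)(x) = ν(k) δ(k)^{1/2} f(k • x)`) and `φ⁰ = 1_{∏ 𝒪_v³}` (`phi0`), and its
`thetaInputOfNonsplit : GenuineThetaInput L S (Lp ℂ 2 (μ L)) (rep L 1) φ⁰ χ`.

The S3 END theorem `exists_compactDomain_thetaLift_ne_zero_genuine_of_input` (pv09-g5, `GenuineThetaInput.lean`)
has, besides the input `X : GenuineThetaInput …` and `hφ : ‖φ‖ = 1` (pv13-g4), three further binders about the pair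
`(ω, φ)`.  For `ω = rep L ν`, `φ = φ⁰` they are THEOREMS, proved here:

* `hK`  (§2) `rep_phi0_eq_self_of_mem_boxSubgroup` : every `k` in the level subgroup `K_T = boxSubgroup (genLevel L) T`
  fixes `φ⁰` (for `ν = 1`; for general `ν` up to the scalar `ν k`, `rep_phi0_of_norm_unitAt`): all split coordinates of
  `k` are units of norm one, which preserve `𝒪_v³` and have module `1`.
* `hM`  (§4) `inner_phi0_rep_extendOne` : the diagonal matrix coefficient of `φ⁰` FACTORISES over the places,
  `⟪φ⁰, ω(extendOne S y) φ⁰⟫ = ∏_{i ∈ S} ⟪φ⁰, ω(ι_i yᵢ) φ⁰⟫` for EVERY finite `S` and every `ν`.  Mechanism: the PRODUCT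
  FORMULA (§3) `vol{x ∈ ∏ 𝒪_v³ | x_j ∈ A_j (j ∈ S)} = ∏_{j ∈ S} vol_j(𝒪_j³ ∩ A_j)` — proved WITHOUT infinite product
  measures, by induction on `S` through uniqueness of Haar measure on each coordinate `(L⁺_v)³` (the constrained
  slice measure is translation invariant and finite on compacts, hence `c •` Haar) — and
  `⟪1_A, ω(k) 1_A⟫ = weight(k) · vol(A ∩ k⁻¹A)` (pv07-g2 `inner_indicator_dilationRep`), so the coefficient is
  `weight(k) · ∏_j vol_j(𝒪³ ∩ u_j⁻¹ 𝒪³)`, multiplicative on disjointly supported pairs; then pv09-g3's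
  `apply_extendOne_of_mulDisjoint`.
* `hloc` (§5) `continuous_rep_mulSingle` : strong continuity of `g ↦ ω(ι_i g) v` on each local group `U(1)_i`
  (for `ν = 1`: `continuous_rep_one_mulSingle'`; for general `ν` given continuity of `g ↦ ν(ι_i g)`).  Mechanism: on the
  OPEN level subgroup `B_i` the embedded elements act by MEASURE-PRESERVING homeomorphisms of `X` depending jointly
  continuously on `(g, x)` (restricted-product topology, `RestrictedProduct.continuous_dom_prod_left`), so Mathlib's
  `Continuous.compMeasurePreservingLp` (continuity of `L²` pull-back along a continuous family of measure-preserving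
  maps) gives continuity on `B_i`; cosets `g₀ B_i` by the group law.  Non-split `i` act trivially (pv13-g4).
* §6: a scalar twist `ν_χ = (χ ∘ pr_nonsplit)⁻¹` making pv13-g4's input available for an ARBITRARY character `χ`
  (`thetaInputTwist`), with `hK` / `hM` / `hloc` for the twisted model (`torusSide_*`), i.e. the (ω, φ)-side
  hypotheses of the END theorem are simultaneously satisfiable for every `χ` meeting the END's `χ`-side hypotheses
  `hχT'`, `hlocχ` (the continuity of `χ ∘ ι_i` at the places off `T'` is pv09-g4's `continuous_localChar_of_not_mem`).

ABSOLUTE RULE respected: every hypothesis of every theorem below is kernel-discharged in this package; no statement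
of PerL / QW8 / the 2001 programme is used; no `axiom`, no proof placeholder.

WHAT THIS DOES NOT SETTLE (GAPS.md `## pub-hodgecm-pv07-g4`): the END theorem's remaining inputs are the DOUBLING /
theta-side data `D : DoublingDatum (Model L) H Sp Sbox`, `GU`, `P : GluePrintInputs …` with `D.ω = rep L ν` — the
genuine Weil representation at the NON-split places and the doubling see-saw (pv12 / pv13 / pv14 lanes) — and the
print-side identification D4(b).  This file only shows that the torus-side binders `hφ`, `hK`, `hM`, `hloc`, `X` are
jointly inhabited by an honest global `L²` model.
-/
import Summits.HodgeConjecture.HodgeCM.PerL34.GenuineSchrodingerModel_2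
import Mathlib.MeasureTheory.Function.LpSpace.ContinuousCompMeasurePreserving

set_option linter.style.longFile 0
set_option linter.unusedSectionVars false
set_option linter.unusedVariables false

noncomputable section

open MeasureTheory MeasureTheory.Measure Set Metric Function Complex ComplexConjugate Topology Filter
open scoped RestrictedProduct InnerProductSpace NNReal ENNReal Pointwise

namespace HodgeCM.PerL34.PureTensor

open HodgeCM.PerL34.LocalFactors HodgeCM.PerL34.LocalFactors.DilationModel
open HodgeCM.PerL34.IdelePlaces HodgeCM.PerL34.RestrictedRegroup HodgeCM.PerL34.RestrictedCutout
open HodgeCM.PerL34.IdelicTorusModel HodgeCM.PerL34.IdelicTorusModel.Genuine NumberField IsDedekindDomain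
open HodgeCM.PerL34.NoSmallSubgroups

attribute [local instance] LocalFactors.DilationModel.Adic.nontriviallyNormedField
  LocalFactors.DilationModel.Adic.properSpace

namespace SchrodingerModel

variable {L : Type} [Field L] [NumberField L] [IsCMField L]

local notation3 "L⁺" => maximalRealSubfield L

/-- shorthand: the base local field `L⁺_v` at a split index -/
local notation3 "𝕂" i => (basePlaceOf L (Subtype.val i)).adicCompletion (maximalRealSubfield L)

namespace Coeff

/-! ## §1  Norm-one units: they preserve the integer cube, the box and the measure -/

/-- (Ported verbatim from the HodgeCMPerL package; no docstring in the source.) -/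
theorem smul_mem_cube_iff (i : SplitIdx L) {u : (𝕂 i)ˣ} (hu : ‖(u : 𝕂 i)‖ = 1) (y : Coord L i) :
    (u : 𝕂 i) • y ∈ cube L i ↔ y ∈ cube L i := by
  rw [mem_cube_iff, mem_cube_iff, norm_smul, hu, one_mul]

/-- (Ported verbatim from the HodgeCMPerL package; no docstring in the source.) -/
theorem preimage_smul_cube (i : SplitIdx L) {u : (𝕂 i)ˣ} (hu : ‖(u : 𝕂 i)‖ = 1) :
    (fun y : Coord L i => (u : 𝕂 i) • y) ⁻¹' (cube L i : Set (Coord L i)) = cube L i := by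
  ext y; exact smul_mem_cube_iff i hu y

/-- (Ported verbatim from the HodgeCMPerL package; no docstring in the source.) -/
theorem norm_unitAt_inv (k : Model L) (j : SplitIdx L) (hk : ‖((unitAt k j : (𝕂 j)ˣ) : 𝕂 j)‖ = 1) :
    ‖((unitAt k⁻¹ j : (𝕂 j)ˣ) : 𝕂 j)‖ = 1 := by
  rw [unitAt_inv, Units.val_inv_eq_inv_val, norm_inv, hk, inv_one]

/-- all split coordinates of norm one ⇒ `k` preserves the box -/
theorem preimage_smul_box (k : Model L) (hk : ∀ j : SplitIdx L, ‖((unitAt k j : (𝕂 j)ˣ) : 𝕂 j)‖ = 1) :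
    (fun x : Space L => k • x) ⁻¹' (box L : Set (Space L)) = box L := by
  ext x
  simp only [mem_preimage, mem_box_iff, smul_apply]
  exact forall_congr' fun j => smul_mem_cube_iff j (hk j) (x j)

/-- (Ported verbatim from the HodgeCMPerL package; no docstring in the source.) -/
theorem smul_mem_box_iff (k : Model L) (hk : ∀ j : SplitIdx L, ‖((unitAt k j : (𝕂 j)ˣ) : 𝕂 j)‖ = 1) (x : Space L) :
    k • x ∈ (box L : Set (Space L)) ↔ x ∈ (box L : Set (Space L)) := by
  rw [← mem_preimage, preimage_smul_box k hk]

/-- (Ported verbatim from the HodgeCMPerL package; no docstring in the source.) -/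
theorem smul_set_box_of_norm (k : Model L) (hk : ∀ j : SplitIdx L, ‖((unitAt k j : (𝕂 j)ˣ) : 𝕂 j)‖ = 1) :
    k • (box L : Set (Space L)) = box L := by
  ext y
  rw [Set.mem_smul_set_iff_inv_smul_mem]
  exact smul_mem_box_iff k⁻¹ (fun j => norm_unitAt_inv k j (hk j)) y

/-- all split coordinates of norm one ⇒ module one -/
theorem distribHaarChar_eq_one_of_norm (k : Model L)
    [∀ v : HeightOneSpectrum (𝓞 (maximalRealSubfield L)), MeasurableSpace (v.adicCompletion (maximalRealSubfield L))]
    [∀ v : HeightOneSpectrum (𝓞 (maximalRealSubfield L)), BorelSpace (v.adicCompletion (maximalRealSubfield L))]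
    (hk : ∀ j : SplitIdx L, ‖((unitAt k j : (𝕂 j)ˣ) : 𝕂 j)‖ = 1) :
    distribHaarChar (Space L) k = 1 := by
  refine distribHaarChar_eq_of_measure_smul_eq_mul (μ := μ L) (s := (box L : Set (Space L)))
    (by rw [μ_box]; exact one_ne_zero) (by rw [μ_box]; exact ENNReal.one_ne_top) ?_
  rw [smul_set_box_of_norm k hk, ENNReal.coe_one, one_mul]

section Main

variable [∀ v : HeightOneSpectrum (𝓞 (maximalRealSubfield L)), MeasurableSpace (v.adicCompletion (maximalRealSubfield L))]
  [∀ v : HeightOneSpectrum (𝓞 (maximalRealSubfield L)), BorelSpace (v.adicCompletion (maximalRealSubfield L))]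
  [DecidableEq (Place (maximalRealSubfield L))]

/-- (Ported verbatim from the HodgeCMPerL package; no docstring in the source.) -/
theorem weight_eq_of_norm (ν : Model L →* Circle) (k : Model L)
    (hk : ∀ j : SplitIdx L, ‖((unitAt k j : (𝕂 j)ˣ) : 𝕂 j)‖ = 1) :
    weight (Space L) ν k = ((ν k : Circle) : ℂ) := by
  rw [weight, distribHaarChar_eq_one_of_norm k hk, NNReal.sqrt_one, NNReal.coe_one, Complex.ofReal_one, mul_one]

/-- the measure `dx` is preserved by every `k` all of whose split coordinates have norm one -/
theorem measurePreserving_smul_of_norm (k : Model L) (hk : ∀ j : SplitIdx L, ‖((unitAt k j : (𝕂 j)ˣ) : 𝕂 j)‖ = 1) :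
    MeasurePreserving (fun x : Space L => k • x) (μ L) (μ L) := by
  refine ⟨measurable_const_smul k, ?_⟩
  rw [map_smul_eq (μ L) k, distribHaarChar_eq_one_of_norm k hk, inv_one, one_smul]

/-! ## §2  `hK`: the level subgroups fix `φ⁰` -/

/-- `ω_ν(k) φ⁰ = ν(k) φ⁰` whenever all split coordinates of `k` have norm one -/
theorem rep_phi0_of_norm_unitAt (ν : Model L →* Circle) (k : Model L)
    (hk : ∀ j : SplitIdx L, ‖((unitAt k j : (𝕂 j)ˣ) : 𝕂 j)‖ = 1) :
    rep L ν k (phi0 L) = ((ν k : Circle) : ℂ) • phi0 L := by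
  apply Lp.ext
  have h1 := coeFn_dilationRep (μ L) ν k (phi0 L)
  have h3 := indicatorConstLp_coeFn (p := 2) (μ := μ L) (hs := (isOpen_box L).measurableSet)
    (hμs := by rw [μ_box]; exact ENNReal.one_ne_top) (c := (1 : ℂ))
  have h2 := (quasiMeasurePreserving_smul' (μ L) k).ae_eq_comp h3
  filter_upwards [h1, h2, h3, Lp.coeFn_smul (((ν k : Circle) : ℂ)) (phi0 L)] with x e1 e2 e3 e4
  rw [e1, e4, Pi.smul_apply, smul_eq_mul, weight_eq_of_norm ν k hk]
  congr 1
  simp only [Function.comp_def] at e2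
  rw [phi0, e2, e3]
  by_cases hx : x ∈ (box L : Set (Space L))
  · rw [indicator_of_mem hx, indicator_of_mem ((smul_mem_box_iff k hk x).2 hx)]
  · rw [indicator_of_notMem hx, indicator_of_notMem (mt (smul_mem_box_iff k hk x).1 hx)]

/-- the split coordinates of an element of a level subgroup `K_T` are units of norm one -/
theorem norm_unitAt_of_mem_boxSubgroup {T : Finset (Place L⁺)} {k : Model L}
    (hk : k ∈ RestrictedProduct.boxSubgroup (genLevel L) T) (j : SplitIdx L) :
    ‖((unitAt k j : (𝕂 j)ˣ) : 𝕂 j)‖ = 1 :=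
  (mem_genLevel_iff_norm_baseTriv_eq_one L j.1 j.2 (k j.1)).1 (((RestrictedProduct.mem_boxSubgroup_iff T k).1 hk).1 j.1)

/-- **`hK` of the END theorem** for the genuine split Schrödinger model: every level subgroup
`K_T = ∏_{v ∉ T} B_v` fixes `φ⁰ = ⊗ 1_{𝒪_v³}`. -/
theorem rep_phi0_eq_self_of_mem_boxSubgroup (T : Finset (Place L⁺)) :
    ∀ k ∈ RestrictedProduct.boxSubgroup (genLevel L) T, rep L 1 k (phi0 L) = phi0 L := fun k hk => by
  rw [rep_phi0_of_norm_unitAt 1 k (norm_unitAt_of_mem_boxSubgroup hk), MonoidHom.one_apply, Circle.coe_one,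
    one_smul]

/-- the same for a character `ν` trivial on `K_T` -/
theorem rep_phi0_eq_self_of_mem_boxSubgroup_of_char (ν : Model L →* Circle) (T : Finset (Place L⁺))
    (hν : ∀ k ∈ RestrictedProduct.boxSubgroup (genLevel L) T, ν k = 1) :
    ∀ k ∈ RestrictedProduct.boxSubgroup (genLevel L) T, rep L ν k (phi0 L) = phi0 L := fun k hk => by
  rw [rep_phi0_of_norm_unitAt ν k (norm_unitAt_of_mem_boxSubgroup hk), hν k hk, Circle.coe_one, one_smul]

/-! ## §3  The product formula `vol{x ∈ ∏ 𝒪³ | x_j ∈ A_j (j ∈ S)} = ∏_{j ∈ S} vol_j(𝒪_j³ ∩ A_j)` -/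

variable (L) in
/-- the sub-box cut out of `∏_v 𝒪_v³` by finitely many coordinate conditions `x_j ∈ A_j`, `j ∈ S` -/
def subbox (S : Finset (SplitIdx L)) (A : ∀ j : SplitIdx L, Set (Coord L j)) : Set (Space L) :=
  (box L : Set (Space L)) ∩ ⋂ j ∈ S, (fun x : Space L => x j) ⁻¹' A j

/-- (Ported verbatim from the HodgeCMPerL package; no docstring in the source.) -/
theorem mem_subbox_iff {S : Finset (SplitIdx L)} {A : ∀ j : SplitIdx L, Set (Coord L j)} (x : Space L) :
    x ∈ subbox L S A ↔ (∀ j, x j ∈ cube L j) ∧ ∀ j ∈ S, x j ∈ A j := by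
  simp only [subbox, mem_inter_iff, mem_box_iff, mem_iInter, mem_preimage]

/-- (Ported verbatim from the HodgeCMPerL package; no docstring in the source.) -/
theorem subbox_empty (A : ∀ j : SplitIdx L, Set (Coord L j)) : subbox L ∅ A = box L := by
  ext x
  simp only [mem_subbox_iff, Finset.notMem_empty, false_imp_iff, imp_true_iff, and_true, mem_box_iff]

/-- (Ported verbatim from the HodgeCMPerL package; no docstring in the source.) -/
theorem measurableSet_subbox (S : Finset (SplitIdx L)) {A : ∀ j : SplitIdx L, Set (Coord L j)}
    (hA : ∀ j, MeasurableSet (A j)) : MeasurableSet (subbox L S A) :=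
  (isOpen_box L).measurableSet.inter (Finset.measurableSet_biInter S fun j _ => measurable_eval j (hA j))

variable (L) in
/-- the constrained cylinder over the `i`-th coordinate: `x_j ∈ 𝒪_j³` for `j ≠ i` and `x_j ∈ A_j` for `j ∈ S ∖ {i}` -/
def cylS (i : SplitIdx L) (S : Finset (SplitIdx L)) (A : ∀ j : SplitIdx L, Set (Coord L j)) : Set (Space L) :=
  cyl L i ∩ ⋂ j ∈ S.erase i, (fun x : Space L => x j) ⁻¹' A j

/-- (Ported verbatim from the HodgeCMPerL package; no docstring in the source.) -/
theorem mem_cylS_iff {i : SplitIdx L} {S : Finset (SplitIdx L)} {A : ∀ j : SplitIdx L, Set (Coord L j)} (x : Space L) :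
    x ∈ cylS L i S A ↔ (∀ j, j ≠ i → x j ∈ cube L j) ∧ ∀ j ∈ S, j ≠ i → x j ∈ A j := by
  simp only [cylS, mem_inter_iff, mem_cyl_iff, mem_iInter, mem_preimage, Finset.mem_erase, ne_eq, and_imp]
  exact ⟨fun h => ⟨h.1, fun j hj hji => h.2 j hji hj⟩, fun h => ⟨h.1, fun j hji hj => h.2 j hj hji⟩⟩

/-- (Ported verbatim from the HodgeCMPerL package; no docstring in the source.) -/
theorem measurableSet_cylS (i : SplitIdx L) (S : Finset (SplitIdx L)) {A : ∀ j : SplitIdx L, Set (Coord L j)}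
    (hA : ∀ j, MeasurableSet (A j)) : MeasurableSet (cylS L i S A) :=
  (measurableSet_cyl i).inter (Finset.measurableSet_biInter _ fun j _ => measurable_eval j (hA j))

/-- (Ported verbatim from the HodgeCMPerL package; no docstring in the source.) -/
theorem cylS_subset_cyl (i : SplitIdx L) (S : Finset (SplitIdx L)) (A : ∀ j : SplitIdx L, Set (Coord L j)) :
    cylS L i S A ⊆ cyl L i := inter_subset_left

/-- slicing the constrained cylinder at `x_i ∈ 𝒪_i³ ∩ A_i` gives the sub-box for `insert i S` -/
theorem cylS_inter_preimage_inter (i : SplitIdx L) (S : Finset (SplitIdx L)) (A : ∀ j : SplitIdx L, Set (Coord L j)) :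
    cylS L i S A ∩ (fun x : Space L => x i) ⁻¹' ((cube L i : Set (Coord L i)) ∩ A i) = subbox L (insert i S) A := by
  ext x
  simp only [mem_inter_iff, mem_cylS_iff, mem_preimage, SetLike.mem_coe, mem_subbox_iff, Finset.mem_insert]
  constructor
  · rintro ⟨⟨h1, h2⟩, h3, h4⟩
    refine ⟨fun j => ?_, fun j hj => ?_⟩
    · by_cases hji : j = i
      · subst hji; exact h3
      · exact h1 j hji
    · by_cases hji : j = i
      · subst hji; exact h4
      · exact h2 j (hj.resolve_left hji) hji
  · rintro ⟨h1, h2⟩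
    exact ⟨⟨fun j _ => h1 j, fun j hj hji => h2 j (Or.inr hj)⟩, h1 i, h2 i (Or.inl rfl)⟩

/-- slicing the constrained cylinder at `x_i ∈ 𝒪_i³` gives the sub-box for `S.erase i` -/
theorem cylS_inter_preimage_cube (i : SplitIdx L) (S : Finset (SplitIdx L)) (A : ∀ j : SplitIdx L, Set (Coord L j)) :
    cylS L i S A ∩ (fun x : Space L => x i) ⁻¹' (cube L i : Set (Coord L i)) = subbox L (S.erase i) A := by
  ext x
  simp only [mem_inter_iff, mem_cylS_iff, mem_preimage, SetLike.mem_coe, mem_subbox_iff, Finset.mem_erase, ne_eq]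
  constructor
  · rintro ⟨⟨h1, h2⟩, h3⟩
    refine ⟨fun j => ?_, fun j hj => h2 j hj.2 hj.1⟩
    by_cases hji : j = i
    · subst hji; exact h3
    · exact h1 j hji
  · rintro ⟨h1, h2⟩
    exact ⟨⟨fun j _ => h1 j, fun j hj hji => h2 j ⟨hji, hj⟩⟩, h1 i⟩

/-- (Ported verbatim from the HodgeCMPerL package; no docstring in the source.) -/
theorem preimage_add_emb_cylS (i : SplitIdx L) (S : Finset (SplitIdx L)) (A : ∀ j : SplitIdx L, Set (Coord L j))
    (a : Coord L i) : (fun x => emb i a + x) ⁻¹' cylS L i S A = cylS L i S A := by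
  ext x
  simp only [mem_preimage, mem_cylS_iff, RestrictedProduct.add_apply]
  refine and_congr (forall₂_congr fun j hj => ?_) (forall₂_congr fun j _ => forall_congr' fun hj => ?_)
  · rw [emb_apply_of_ne i a hj, zero_add]
  · rw [emb_apply_of_ne i a hj, zero_add]

variable (L) in
/-- the constrained slice measure: `dx` restricted to the constrained cylinder, pushed to the `i`-th coordinate -/
def sliceS (i : SplitIdx L) (S : Finset (SplitIdx L)) (A : ∀ j : SplitIdx L, Set (Coord L j)) : Measure (Coord L i) :=
  ((μ L).restrict (cylS L i S A)).map (fun x : Space L => x i)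

/-- (Ported verbatim from the HodgeCMPerL package; no docstring in the source.) -/
theorem sliceS_apply (i : SplitIdx L) (S : Finset (SplitIdx L)) {A : ∀ j : SplitIdx L, Set (Coord L j)}
    (hA : ∀ j, MeasurableSet (A j)) {E : Set (Coord L i)} (hE : MeasurableSet E) :
    sliceS L i S A E = μ L (cylS L i S A ∩ (fun x : Space L => x i) ⁻¹' E) := by
  rw [sliceS, Measure.map_apply (measurable_eval i) hE, Measure.restrict_apply' (measurableSet_cylS i S hA),
    inter_comm]

/-- the constrained slice measure is translation invariant -/
theorem isAddLeftInvariant_sliceS (i : SplitIdx L) (S : Finset (SplitIdx L)) {A : ∀ j : SplitIdx L, Set (Coord L j)}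
    (hA : ∀ j, MeasurableSet (A j)) : (sliceS L i S A).IsAddLeftInvariant := by
  refine ⟨fun a => ?_⟩
  rw [sliceS, Measure.map_map (measurable_const_add a) (measurable_eval i)]
  have hcomp : ((fun y : Coord L i => a + y) ∘ fun x : Space L => x i) =
      (fun x : Space L => x i) ∘ fun x => emb i a + x := by
    funext x
    simp only [Function.comp_apply, RestrictedProduct.add_apply, emb_apply_self]
  rw [hcomp, ← Measure.map_map (measurable_eval i) (measurable_const_add _)]
  congr 1
  have h := Measure.restrict_map (μ := μ L) (measurable_const_add (emb i a)) (measurableSet_cylS i S hA)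
  rw [preimage_add_emb_cylS, map_add_left_eq_self] at h
  exact h.symm

/-- the constrained slice measure is dominated by the slice measure, hence finite on compacts -/
theorem isFiniteMeasureOnCompacts_sliceS (i : SplitIdx L) (S : Finset (SplitIdx L))
    {A : ∀ j : SplitIdx L, Set (Coord L j)} (hA : ∀ j, MeasurableSet (A j)) :
    IsFiniteMeasureOnCompacts (sliceS L i S A) := by
  refine ⟨fun C hC => ?_⟩
  rw [sliceS_apply i S hA hC.measurableSet]
  refine lt_of_le_of_lt (measure_mono (inter_subset_inter_left _ (cylS_subset_cyl i S A))) ?_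
  rw [← sliceMeasure_apply i hC.measurableSet]
  exact hC.measure_lt_top

/-- **the product formula**: `vol{x ∈ ∏_v 𝒪_v³ | x_j ∈ A_j for j ∈ S} = ∏_{j ∈ S} vol_j(𝒪_j³ ∩ A_j)`
(induction on `S` through uniqueness of Haar measure on each coordinate — no infinite product measure needed). -/
theorem measure_subbox {A : ∀ j : SplitIdx L, Set (Coord L j)} (hA : ∀ j, MeasurableSet (A j))
    (S : Finset (SplitIdx L)) :
    μ L (subbox L S A) = ∏ j ∈ S, Adic.muV L⁺ (basePlaceOf L j.1) ((cube L j : Set (Coord L j)) ∩ A j) := by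
  induction S using Finset.induction_on with
  | empty => rw [Finset.prod_empty, subbox_empty, μ_box]
  | insert i S hi ih =>
    haveI := isAddLeftInvariant_sliceS i S hA
    haveI := isFiniteMeasureOnCompacts_sliceS i S hA
    have huniq := addHaarMeasure_unique (sliceS L i S A) (Adic.integerCube L⁺ (basePlaceOf L i.1))
    have hK₀ : sliceS L i S A (Adic.integerCube L⁺ (basePlaceOf L i.1)) =
        ∏ j ∈ S, Adic.muV L⁺ (basePlaceOf L j.1) ((cube L j : Set (Coord L j)) ∩ A j) := by
      rw [show ((Adic.integerCube L⁺ (basePlaceOf L i.1) : TopologicalSpace.PositiveCompacts (Coord L i)) :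
          Set (Coord L i)) = (cube L i : Set (Coord L i)) from rfl,
        sliceS_apply i S hA (cube L i).isOpen.measurableSet, cylS_inter_preimage_cube, Finset.erase_eq_of_notMem hi, ih]
    rw [Finset.prod_insert hi, ← cylS_inter_preimage_inter,
      ← sliceS_apply i S hA ((cube L i).isOpen.measurableSet.inter (hA i)), huniq, Measure.smul_apply, hK₀,
      smul_eq_mul, mul_comm, Adic.muV]

/-! ## §4  `hM`: the diagonal coefficient of `φ⁰` and its factorisation -/

/-- the local overlap volume `vol_v(𝒪_v³ ∩ u⁻¹ 𝒪_v³)` of a unit `u ∈ (L⁺_v)ˣ` -/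
def locVol (j : SplitIdx L) (u : (𝕂 j)ˣ) : ℝ≥0∞ :=
  Adic.muV L⁺ (basePlaceOf L j.1)
    ((cube L j : Set (Coord L j)) ∩ (fun y : Coord L j => (u : 𝕂 j) • y) ⁻¹' (cube L j : Set (Coord L j)))

/-- (Ported verbatim from the HodgeCMPerL package; no docstring in the source.) -/
theorem locVol_of_norm (j : SplitIdx L) {u : (𝕂 j)ˣ} (hu : ‖(u : 𝕂 j)‖ = 1) : locVol j u = 1 := by
  rw [locVol, preimage_smul_cube j hu, inter_self,
    show (cube L j : Set (Coord L j)) = (Adic.integerCube L⁺ (basePlaceOf L j.1) : Set (Coord L j)) from rfl,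
    Adic.muV, addHaarMeasure_self]

/-- (Ported verbatim from the HodgeCMPerL package; no docstring in the source.) -/
@[simp] theorem locVol_one (j : SplitIdx L) : locVol j 1 = 1 :=
  locVol_of_norm j (by rw [Units.val_one, norm_one])

/-- the overlap `box ∩ k⁻¹ box` is a sub-box, for any finite `S` containing the non-norm-one split coordinates -/
theorem box_inter_preimage_smul_box (k : Model L) (S : Finset (SplitIdx L))
    (hS : ∀ j : SplitIdx L, j ∉ S → ‖((unitAt k j : (𝕂 j)ˣ) : 𝕂 j)‖ = 1) :
    (box L : Set (Space L)) ∩ (fun x : Space L => k • x) ⁻¹' (box L : Set (Space L)) =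
      subbox L S (fun j => (fun y : Coord L j => ((unitAt k j : (𝕂 j)ˣ) : 𝕂 j) • y) ⁻¹' (cube L j : Set (Coord L j))) := by
  ext x
  simp only [mem_inter_iff, mem_preimage, mem_subbox_iff, SetLike.mem_coe]
  constructor
  · rintro ⟨h1, h2⟩
    exact ⟨h1, fun j _ => h2 j⟩
  · rintro ⟨h1, h2⟩
    refine ⟨h1, fun j => ?_⟩
    by_cases hj : j ∈ S
    · exact h2 j hj
    · exact (smul_mem_cube_iff j (hS j hj) (x j)).2 (h1 j)

/-- (Ported verbatim from the HodgeCMPerL package; no docstring in the source.) -/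
theorem measure_box_inter_preimage_smul_box (k : Model L) (S : Finset (SplitIdx L))
    (hS : ∀ j : SplitIdx L, j ∉ S → ‖((unitAt k j : (𝕂 j)ˣ) : 𝕂 j)‖ = 1) :
    μ L ((box L : Set (Space L)) ∩ (fun x : Space L => k • x) ⁻¹' (box L : Set (Space L))) =
      ∏ j ∈ S, locVol j (unitAt k j) := by
  rw [box_inter_preimage_smul_box k S hS,
    measure_subbox (fun j => (cube L j).isOpen.measurableSet.preimage (measurable_const_smul _)) S]
  rfl

/-- the finite set of split indices where `k` is NOT a norm-one unit -/
def exc (k : Model L) : Finset (SplitIdx L) :=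
  (Filter.eventually_cofinite.1 (eventually_norm_unitAt_eq_one k)).toFinset

/-- (Ported verbatim from the HodgeCMPerL package; no docstring in the source.) -/
theorem norm_unitAt_of_not_mem_exc (k : Model L) {j : SplitIdx L} (hj : j ∉ exc k) :
    ‖((unitAt k j : (𝕂 j)ˣ) : 𝕂 j)‖ = 1 := by
  by_contra h
  exact hj ((Set.Finite.mem_toFinset _).2 h)


-- port_pkg: scope closed for this part
end Main
end Coeff
end SchrodingerModel
end HodgeCM.PerL34.PureTensor
end
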